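import Mathlib.MeasureTheory.Group.LIntegral
import Literature.Analysis.FunctionSpaces.TorusLatticeCells
import Literature.Analysis.FunctionSpaces.TorusCellAveragesProofs
import HarnessLib

/-!
# Cells of mesh `1/N` in `ℝ^d`: translation, and integrals of `(1/N)ℤ^d`-invariant integrands

Analysis/FunctionSpaces support file (companion of `TorusLatticeCells`), the measure-theoretic
half of the "division of `𝕋^d` into `λ^d` small cubes `Q_j` of edge `1/λ`" in the proof of the
improved Hölder inequality of Modena–Székelyhidi (Ann. PDE 4 (2018), Lemma 2.1: "since
`g_λ(x) = g(λx)` … `∫_{Q_j} |g_λ|^p = λ^{-d} ∫_{𝕋^d} |g|^p`"), used by `TorusImprovedHolder`: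

* `Torus.cellCorner N κ = κ/N`, `Torus.mem_latticeCell_fin_iff` — the half-open cell `Q_κ` of
  mesh `1/N` (`Torus.latticeCell N κ`, `κ : d → Fin N`) is the translate of `Q_0` by `κ/N`;
* `Torus.setLIntegral_latticeCell_eq_translate` — `∫_{Q_κ} G = ∫_{Q_0} G(· + κ/N)` for every
  `G ≥ 0` (translation invariance of Lebesgue measure on `ℝ^d`), hence all cell integrals of a
  `(1/N)ℤ^d`-invariant integrand agree (`Torus.setLIntegral_latticeCell_eq_of_invariant`);
* `Torus.card_mul_setLIntegral_cell_eq_lintegral` — for `φ ≥ 0` on `T^d` invariant under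
  `x ↦ x + κ/N`: `N^d ∫_{Q_κ} φ∘proj = ∫_{T^d} φ` (the torus integral is the integral of the lift
  over `[0,1)^d = ⋃_κ Q_κ`, `Torus.lintegral_eq_setLIntegral_unitCube_lift` of
  `TorusCellAveragesProofs` and `Torus.setLIntegral_unitCube_eq_sum_latticeCell`);
* `Torus.norm_sub_le_of_mem_latticeCell` — two points of a half-open cell are at distance
  `≤ √d/N` (the half-open twin of `Torus.norm_sub_le_of_mem_latticeCellInterior`).

All proved (folklore measure theory).

## References

* S. Modena, L. Székelyhidi Jr., Ann. PDE 4 (2018) = arXiv:1712.03867, §2.1, proof of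
  Lemma 2.1. [`ModenaSzekelyhidi2018`]
-/

noncomputable section

open MeasureTheory Set Filter Function
open scoped ENNReal NNReal

namespace Literature.Analysis.FunctionSpaces

namespace Torus

variable {d : Type*} [Fintype d]

/-! ## Cells of mesh `1/N`: translation and invariance -/

section Cells

variable [DecidableEq d] {N : ℕ}

/-- The lower corner `κ/N ∈ ℝ^d` of the cell of index `κ : d → Fin N`. [folklore] -/
def cellCorner (N : ℕ) (κ : d → Fin N) : EuclideanSpace ℝ d :=
  (N : ℝ)⁻¹ • latticeVec fun i => ((κ i : ℕ) : ℤ)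

/-- Coordinates of the corner: `(κ/N)_i = κ_i / N`. [folklore] -/
theorem cellCorner_apply (κ : d → Fin N) (i : d) : cellCorner N κ i = ((κ i : ℕ) : ℝ) / N := by
  simp [cellCorner, latticeVec_apply, div_eq_inv_mul]

/-- **The cell of index `κ` is the translate of the cell of index `0` by `κ/N`**:
`y ∈ Q_κ ↔ y - κ/N ∈ Q_0`. [folklore] -/
theorem mem_latticeCell_fin_iff (hN : 0 < N) (κ : d → Fin N) (y : EuclideanSpace ℝ d) :
    y ∈ latticeCell N (fun i => ((κ i : ℕ) : ℤ)) ↔ y - cellCorner N κ ∈ latticeCell N (0 : d → ℤ) := by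
  have hN' : (0 : ℝ) < N := by exact_mod_cast hN
  simp only [mem_latticeCell, mem_Ico, PiLp.sub_apply, cellCorner_apply, Pi.zero_apply,
    Int.cast_zero, zero_div, zero_add, Int.cast_natCast]
  refine forall_congr' fun i => ?_
  constructor
  · rintro ⟨h1, h2⟩
    refine ⟨by linarith, ?_⟩
    have : ((κ i : ℕ) : ℝ) / N + 1 / N = (((κ i : ℕ) : ℝ) + 1) / N := by ring
    linarith
  · rintro ⟨h1, h2⟩
    refine ⟨by linarith, ?_⟩
    have : ((κ i : ℕ) : ℝ) / N + 1 / N = (((κ i : ℕ) : ℝ) + 1) / N := by ring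
    linarith

/-- **Cell integrals as integrals over the cell at the origin**: for every `G ≥ 0`,
`∫_{Q_κ} G = ∫_{Q_0} G(· + κ/N)` (translation invariance of Lebesgue measure on `ℝ^d`). [folklore] -/
theorem setLIntegral_latticeCell_eq_translate (hN : 0 < N) (κ : d → Fin N)
    (G : EuclideanSpace ℝ d → ℝ≥0∞) :
    ∫⁻ y in latticeCell N (fun i => ((κ i : ℕ) : ℤ)), G y =
      ∫⁻ y in latticeCell N (0 : d → ℤ), G (y + cellCorner N κ) := by
  rw [← lintegral_indicator measurableSet_latticeCell,
    ← lintegral_indicator measurableSet_latticeCell,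
    ← lintegral_add_right_eq_self
      (fun y => (latticeCell N (fun i => ((κ i : ℕ) : ℤ))).indicator G y) (cellCorner N κ)]
  refine lintegral_congr fun y => ?_
  simp only [Set.indicator]
  have h : y + cellCorner N κ ∈ latticeCell N (fun i => ((κ i : ℕ) : ℤ)) ↔
      y ∈ latticeCell N (0 : d → ℤ) := by
    rw [mem_latticeCell_fin_iff hN κ, add_sub_cancel_right]
  by_cases hy : y ∈ latticeCell N (0 : d → ℤ)
  · rw [if_pos (h.mpr hy), if_pos hy]
  · rw [if_neg (fun h' => hy (h.mp h')), if_neg hy]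

/-- **All cell integrals of a `(1/N)ℤ^d`-invariant integrand coincide** with the one over
`Q_0`. [folklore] -/
theorem setLIntegral_latticeCell_eq_of_invariant (hN : 0 < N) {G : EuclideanSpace ℝ d → ℝ≥0∞}
    (hG : ∀ (y : EuclideanSpace ℝ d) (κ : d → Fin N), G (y + cellCorner N κ) = G y)
    (κ : d → Fin N) :
    ∫⁻ y in latticeCell N (fun i => ((κ i : ℕ) : ℤ)), G y = ∫⁻ y in latticeCell N (0 : d → ℤ), G y := by
  rw [setLIntegral_latticeCell_eq_translate hN κ G]
  exact lintegral_congr fun y => hG y κ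

omit [DecidableEq d] in
/-- `N^d · vol(Q) = 1` in `ℝ≥0∞` for the cells of mesh `1/N`. [folklore] -/
theorem card_mul_volume_cell (hN : 0 < N) :
    ((N : ℝ≥0∞) ^ Fintype.card d) * ENNReal.ofReal ((N : ℝ)⁻¹) ^ Fintype.card d = 1 := by
  rw [← mul_pow]
  have hN' : (0 : ℝ) < N := by exact_mod_cast hN
  rw [ENNReal.ofReal_inv_of_pos hN', ENNReal.ofReal_natCast,
    ENNReal.mul_inv_cancel (by exact_mod_cast hN.ne') (ENNReal.natCast_ne_top N), one_pow]

/-- **A `(1/N)ℤ^d`-invariant integrand: `N^d` times any one cell integral is the integral over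
the torus** (`∫_{T^d} φ = ∑_κ ∫_{Q_κ} φ∘proj` and all cell integrals agree). [folklore] -/
theorem card_mul_setLIntegral_cell_eq_lintegral (hN : 0 < N) {φ : UnitAddTorus d → ℝ≥0∞}
    (hφ : AEMeasurable φ volume)
    (hper : ∀ (x : UnitAddTorus d) (κ : d → Fin N), φ (x + proj (cellCorner N κ)) = φ x)
    (κ₀ : d → Fin N) :
    ((N : ℝ≥0∞) ^ Fintype.card d) * ∫⁻ y in latticeCell N (fun i => ((κ₀ i : ℕ) : ℤ)), φ (proj y) =
      ∫⁻ x, φ x := by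
  have hG : ∀ (y : EuclideanSpace ℝ d) (κ : d → Fin N), φ (proj (y + cellCorner N κ)) = φ (proj y) :=
    fun y κ => by rw [proj_add, hper]
  rw [lintegral_eq_setLIntegral_unitCube_lift hφ, setLIntegral_unitCube_eq_sum_latticeCell hN,
    Finset.sum_congr rfl fun κ _ => setLIntegral_latticeCell_eq_of_invariant hN hG κ,
    setLIntegral_latticeCell_eq_of_invariant hN hG κ₀, Finset.sum_const, Finset.card_univ,
    Fintype.card_fun, Fintype.card_fin, nsmul_eq_mul]
  push_cast
  ring

omit [DecidableEq d] in
/-- Two points of a half-open cell of mesh `1/N` are at distance `≤ √d/N`. [folklore] -/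
theorem norm_sub_le_of_mem_latticeCell (hN : 0 < N) {κ : d → ℤ} {x y : EuclideanSpace ℝ d}
    (hx : x ∈ latticeCell N κ) (hy : y ∈ latticeCell N κ) :
    ‖y - x‖ ≤ Real.sqrt (Fintype.card d) / N := by
  have hN' : (0 : ℝ) < N := by exact_mod_cast hN
  have hcoord : ∀ i, (y - x) i ^ 2 ≤ ((N : ℝ)⁻¹) ^ 2 := by
    intro i
    have hxi := hx i
    have hyi := hy i
    have hw : ((κ i : ℝ) + 1) / N - (κ i : ℝ) / N = (N : ℝ)⁻¹ := by
      field_simp; ring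
    have h1 : |(y - x) i| ≤ (N : ℝ)⁻¹ := by
      rw [abs_le, PiLp.sub_apply]
      have := hxi.1; have := hxi.2; have := hyi.1; have := hyi.2
      constructor <;> linarith
    calc (y - x) i ^ 2 = |(y - x) i| ^ 2 := (sq_abs _).symm
      _ ≤ ((N : ℝ)⁻¹) ^ 2 := pow_le_pow_left₀ (abs_nonneg _) h1 2
  rw [EuclideanSpace.norm_eq, div_eq_mul_inv, ← Real.sqrt_sq (inv_nonneg.2 hN'.le),
    ← Real.sqrt_mul (Nat.cast_nonneg _)]
  refine Real.sqrt_le_sqrt ?_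
  calc ∑ i, ‖(y - x) i‖ ^ 2 = ∑ i, (y - x) i ^ 2 := by simp [Real.norm_eq_abs, sq_abs]
    _ ≤ ∑ _i : d, ((N : ℝ)⁻¹) ^ 2 := Finset.sum_le_sum fun i _ => hcoord i
    _ = Fintype.card d * ((N : ℝ)⁻¹) ^ 2 := by simp

end Cells

end Torus

end Literature.Analysis.FunctionSpaces

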